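import Literature.NumberTheory.Automorphic.FixedPointsTorusDoubleCosetCount         -- ★ (F3c-α) B-p04: Cor. 9 counted, generic
import Literature.NumberTheory.Automorphic.UnitaryThreeKHFactorization             -- ★ (F3c-β) B-p04: Prop. 8 (i) `hKPM`, `hMK`
import Literature.NumberTheory.Automorphic.UnitaryThreeDoubleCosetsHKDefs           -- ★ B-p17 DEFS `flickerKH ∕ flickerHK ∕ flickerPH`
import HarnessLib

/-!
# Flicker's Cor. 9, COUNTED, IN THE FLICKER FRAME: `#{x ∈ H ⧸ H^K_m : t·x = x} = Σᶠᵢ [T : T ∩ rᵢ K_H rᵢ⁻¹] · #{y ∈ P_H ⧸ (P_H ∩ H^K_m) : ỹ⁻¹ (rᵢ⁻¹ t rᵢ) ỹ ∈ H^K_m}`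
(Flicker, *Elementary proof of the fundamental lemma for a unitary group* (1998), Cor. 9 p. 85; Prop. 6 p. 83; Prop. 8 p. 84)

Topic `NumberTheory/Automorphic`; namespace `Literature.NumberTheory.Automorphic.UnitaryGroup`.  THEOREMS ONLY (no `def`, no instance, no notation, no named fact,
no `sorry`; one `synthInstance.maxHeartbeats` bump for the `MulAction` instance on `↥H ⧸ M`).  Cell `pub/hodgecm-mathlib`, F0∕P3a road «N7-ns COUNT FROM FLICKER»
(MAP v3, architect A-p06 (g26)), brick **(F3c-C9-inst)** (B-p04 (g33), self-dealt 05:26Z): ★ (F3c-α) `DoubleCosetFixedPoints.natCard_fixedPoints_eq_finsum_relIndex_mul`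
(p840967, generic group theory) INSTANTIATED at `G := ↥H`, `H = Z_U(c)`, `K := K_H`, `M := H^K_m`, `P := P_H` (★ B-p17 DEFS `flickerKH ∕ flickerHK ∕ flickerPH`, read
inside `H` by `subgroupOf`), with the three Prop-8 hypotheses `hMK` ∕ `hPK` ∕ `hKPM` DISCHARGED by ★ (F3c-β) p841018 and the inner count TRANSPORTED to the `U`-level coset
currency of ★ A-p03 `natCard_cosets_eq_iTen` (Prop. 10).  What stays hypothetical: Prop. 6 — `hA` (★ B-p12 `exists_mem_centralizer_mul_diagRadial_mul_mem_flickerKH`,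
same binder shape), `hB`, and the weights `[T : T ∩ rᵢ K_H rᵢ⁻¹]` ((F3c-γ), B-p12 (g28)) — and the finiteness of the fixed-point set.  HC_CM is proved only modulo the
printed citations until rung 0 closes; structure theory for ONE clause of #103-ns, pays nothing by itself.

* `flickerHK_le_flickerKH` (`H^K_m ≤ K_H`, ★ `mem_unitaryInt_of_flickerU_conj_mem`), `flickerPH_le_flickerKH`, `flickerKH_le_centralizer`;
  `exists_mem_flickerPH_mul_mem_flickerHK` (= `hKPM` inside `↥H`, ★ `exists_upper_mul_of_mem_centralizer_unitaryInt`).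
* `inv_mul_mul_mem_iff_of_mem`, **`natCard_cosets_subgroupOf_eq`** (generic transport: the inner count read with `P.subgroupOf H`, `M.subgroupOf H` inside `↥H` equals
  the count read with `P`, `M` inside `U` — `Subgroup.subgroupOfEquivOfLe` + `Quotient.congr` + right-`M`-invariance of the predicate).
* **`natCard_fixedPoints_centralizer_eq_finsum (hJ) (hd) (hy) (m) (hum) (hc) (r : ι → ↥H) (t : ↥H) (T : Subgroup ↥H) (ht) (hA) (hB) (hfin)`** — the displayed identity,
  inner sets `{w : ↥(flickerPH σ J c) ⧸ (flickerHK σ J c um).subgroupOf _ // (↑(out w))⁻¹ * ↑((r i)⁻¹ * t * r i) * ↑(out w) ∈ flickerHK σ J c um}` VERBATIM as in Prop. 10.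

## References
* [Flicker1998UnitaryFL] Y. Z. Flicker, *Elementary proof of the fundamental lemma for a unitary group*, Canad. J. Math. 50 (1998), Prop. 6 p. 83, Prop. 8 p. 84, Cor. 9 p. 85.
-/

open scoped MatrixGroups WithZero
open Matrix

namespace Literature.NumberTheory.Automorphic

namespace UnitaryGroup

open Literature.NumberTheory.Automorphic.HermitianLattice (unitaryInt mem_unitaryInt_iff LocalConjDatum)
open Literature.NumberTheory.Automorphic.DoubleCosetFixedPoints

section Frame

variable {K : Type*} [Field K] [Valued K ℤᵐ⁰] {ϖ : K} (σ : K →+* K) {J : Matrix (Fin 3) (Fin 3) K} (hJ : J = (StdForm.antidiagonal 3).over K)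

/-- `H^K_m ≤ K_H` (★ `mem_unitaryInt_of_flickerU_conj_mem`, as an inclusion of subgroups). [cite: Flicker1998UnitaryFL, Prop. 8 p. 84] -/
theorem flickerHK_le_flickerKH (hJ : J = (StdForm.antidiagonal 3).over K) (hd : LocalConjDatum σ ϖ) {y : K} (hy : y * σ y = -2) (m : ℕ)
    {um c : ↥(unitaryGroupOfForm σ J)}
    (hum : ((um : GL (Fin 3) K) : Matrix (Fin 3) (Fin 3) K) = !![ϖ ^ m, y, (ϖ ^ m)⁻¹; 0, 1, -σ y * (ϖ ^ m)⁻¹; 0, 0, (ϖ ^ m)⁻¹])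
    (hc : ((c : GL (Fin 3) K) : Matrix (Fin 3) (Fin 3) K) = !![1, 0, 0; 0, -1, 0; 0, 0, 1]) :
    flickerHK σ J c um ≤ flickerKH σ J c := by
  intro h hh
  rw [mem_flickerHK_iff] at hh
  exact mem_flickerKH_iff.2 ⟨hh.1, mem_unitaryInt_of_flickerU_conj_mem σ hJ hd hy m hum hc hh.1 hh.2⟩

/-- **Prop. 8 (i) as the hypothesis `hKPM` inside `H`**: every `k ∈ K_H` is `p · x` with `p ∈ P_H`, `x ∈ H^K_m` (all read in `↥H`).
[cite: Flicker1998UnitaryFL, Prop. 8 p. 84] -/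
theorem exists_mem_flickerPH_mul_mem_flickerHK (hJ : J = (StdForm.antidiagonal 3).over K) (hd : LocalConjDatum σ ϖ) {y : K} (hy : y * σ y = -2)
    (m : ℕ) {um c : ↥(unitaryGroupOfForm σ J)}
    (hum : ((um : GL (Fin 3) K) : Matrix (Fin 3) (Fin 3) K) = !![ϖ ^ m, y, (ϖ ^ m)⁻¹; 0, 1, -σ y * (ϖ ^ m)⁻¹; 0, 0, (ϖ ^ m)⁻¹])
    (hc : ((c : GL (Fin 3) K) : Matrix (Fin 3) (Fin 3) K) = !![1, 0, 0; 0, -1, 0; 0, 0, 1])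
    (k : ↥(Subgroup.centralizer ({c} : Set ↥(unitaryGroupOfForm σ J))))
    (hk : k ∈ (flickerKH σ J c).subgroupOf (Subgroup.centralizer ({c} : Set ↥(unitaryGroupOfForm σ J)))) :
    ∃ p ∈ (flickerPH σ J c).subgroupOf (Subgroup.centralizer ({c} : Set ↥(unitaryGroupOfForm σ J))),
      ∃ x ∈ (flickerHK σ J c um).subgroupOf (Subgroup.centralizer ({c} : Set ↥(unitaryGroupOfForm σ J))), k = p * x := by
  have h2 : (2 : K) ≠ 0 := fun h => by have := hd.v2; rw [h, map_zero] at this; exact zero_ne_one this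
  rw [Subgroup.mem_subgroupOf, mem_flickerKH_iff] at hk
  obtain ⟨p, x, ⟨hpH, hpK, hp20⟩, ⟨hxH, hxu⟩, hkpx⟩ := exists_upper_mul_of_mem_centralizer_unitaryInt σ hJ hd hy m hum hc hk.1 hk.2
  refine ⟨⟨p, hpH⟩, ?_, ⟨x, hxH⟩, ?_, Subtype.ext hkpx⟩
  · rw [Subgroup.mem_subgroupOf, mem_flickerPH_iff h2 hc, mem_flickerKH_iff]
    exact ⟨⟨hpH, hpK⟩, hp20⟩
  · rw [Subgroup.mem_subgroupOf, mem_flickerHK_iff]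
    exact ⟨hxH, hxu⟩

end Frame

section Transport

variable {U : Type*} [Group U] (H P M : Subgroup U)

/-- Conjugating by an element of `M` does not change membership in `M`: `(a s)⁻¹ g (a s) ∈ M ↔ a⁻¹ g a ∈ M` for `s ∈ M`. [cite: Flicker1998UnitaryFL, Cor. 9 p. 85] -/
theorem inv_mul_mul_mem_iff_of_mem {a s g : U} (hs : s ∈ M) : (a * s)⁻¹ * g * (a * s) ∈ M ↔ a⁻¹ * g * a ∈ M := by
  have e : (a * s)⁻¹ * g * (a * s) = s⁻¹ * (a⁻¹ * g * a) * s := by group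
  rw [e]
  constructor
  · intro h
    have h' := M.mul_mem (M.mul_mem hs h) (M.inv_mem hs)
    have e' : s * (s⁻¹ * (a⁻¹ * g * a) * s) * s⁻¹ = a⁻¹ * g * a := by group
    rwa [e'] at h'
  · intro h
    exact M.mul_mem (M.mul_mem (M.inv_mem hs) h) hs

/-- **TRANSPORT OF THE INNER COUNT from `↥H`-subgroups to `U`-subgroups**: for `P ≤ H` and `g ∈ H`, the cosets `y ∈ P ⧸ (P ∩ M)` with `ỹ⁻¹ g ỹ ∈ M` are
counted the same whether `P`, `M` are read inside `H` (`P.subgroupOf H`, `M.subgroupOf H` — the frame of ★ `natCard_fixedPoints_eq_finsum_relIndex_mul` at `G := ↥H`)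
or inside `U` (the frame of ★ `natCard_cosets_eq_iTen`). [cite: Flicker1998UnitaryFL, Cor. 9 p. 85] -/
theorem natCard_cosets_subgroupOf_eq (hPH : P ≤ H) (g : ↥H) :
    Nat.card {y : ↥(P.subgroupOf H) ⧸ (M.subgroupOf H).subgroupOf (P.subgroupOf H) //
        ((Quotient.out y : ↥(P.subgroupOf H)) : ↥H)⁻¹ * g * (Quotient.out y : ↥(P.subgroupOf H)) ∈ M.subgroupOf H} =
      Nat.card {y : ↥P ⧸ M.subgroupOf P // ((Quotient.out y : ↥P) : U)⁻¹ * (g : U) * (Quotient.out y : ↥P) ∈ M} := by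
  set e : ↥(P.subgroupOf H) ≃* ↥P := Subgroup.subgroupOfEquivOfLe hPH with he_def
  have he : ∀ a : ↥(P.subgroupOf H), ((e a : ↥P) : U) = ((a : ↥H) : U) := fun a => rfl
  have hrel : ∀ a b : ↥(P.subgroupOf H), QuotientGroup.leftRel ((M.subgroupOf H).subgroupOf (P.subgroupOf H)) a b ↔
      QuotientGroup.leftRel (M.subgroupOf P) (e a) (e b) := by
    intro a b
    rw [QuotientGroup.leftRel_apply, QuotientGroup.leftRel_apply, Subgroup.mem_subgroupOf, Subgroup.mem_subgroupOf, Subgroup.mem_subgroupOf,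
      ← map_inv, ← map_mul]
    rfl
  let E : ↥(P.subgroupOf H) ⧸ (M.subgroupOf H).subgroupOf (P.subgroupOf H) ≃ ↥P ⧸ M.subgroupOf P := Quotient.congr e.toEquiv hrel
  refine Nat.card_congr (E.subtypeEquiv fun y => ?_)
  -- the predicate is invariant under the change of representative
  induction y using QuotientGroup.induction_on with | H a => ?_
  have hE : E (QuotientGroup.mk a) = QuotientGroup.mk (e a) := Quotient.congr_mk _ hrel a
  rw [hE]
  obtain ⟨s, hs⟩ := QuotientGroup.mk_out_eq_mul ((M.subgroupOf H).subgroupOf (P.subgroupOf H)) a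
  obtain ⟨s', hs'⟩ := QuotientGroup.mk_out_eq_mul (M.subgroupOf P) (e a)
  rw [hs, hs', Subgroup.mem_subgroupOf]
  simp only [Subgroup.coe_mul, InvMemClass.coe_inv, he]
  have hsM : (((s : ↥(P.subgroupOf H)) : ↥H) : U) ∈ M := by
    have := s.2; rw [Subgroup.mem_subgroupOf, Subgroup.mem_subgroupOf] at this; exact this
  have hs'M : ((s' : ↥P) : U) ∈ M := by
    have := s'.2; rw [Subgroup.mem_subgroupOf] at this; exact this
  rw [inv_mul_mul_mem_iff_of_mem M hsM, inv_mul_mul_mem_iff_of_mem M hs'M]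

end Transport

section CorNine

variable {K : Type*} [Field K] [Valued K ℤᵐ⁰] {ϖ : K} (σ : K →+* K) {J : Matrix (Fin 3) (Fin 3) K}

/-- `P_H ≤ K_H ≤ H`. [cite: Flicker1998UnitaryFL, Prop. 8 p. 84] -/
theorem flickerPH_le_flickerKH (c : ↥(unitaryGroupOfForm σ J)) : flickerPH σ J c ≤ flickerKH σ J c :=
  fun _ h => (mem_flickerPH_iff'.1 h).1

/-- `K_H ≤ H`. [cite: Flicker1998UnitaryFL, §3 p. 80] -/
theorem flickerKH_le_centralizer (c : ↥(unitaryGroupOfForm σ J)) :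
    flickerKH σ J c ≤ Subgroup.centralizer ({c} : Set ↥(unitaryGroupOfForm σ J)) :=
  fun _ h => (mem_flickerKH_iff.1 h).1

set_option synthInstance.maxHeartbeats 120000 in
/-- **FLICKER'S COR. 9, COUNTED, IN THE FLICKER FRAME.**  `U = U(σ, Φ₃)`, `H = Z_U(c)`, `c = diag(1,−1,1)`, `K_H`, `H^K_m` (`u_m`), `P_H` as in ★ (F1) ∕ ★ DEFS;
`t ∈ H`, `T ≤ H` centralising `t`, representatives `r : ι → H` with `H = ⊔ᵢ T·rᵢ·K_H` (Prop. 6: existence `hA`, disjointness `hB` — (F3c-γ), B-p12), finitely many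
fixed points.  Then
`#{x ∈ H ⧸ H^K_m : t·x = x} = Σᶠᵢ [T : T ∩ rᵢ K_H rᵢ⁻¹] · #{y ∈ P_H ⧸ (P_H ∩ H^K_m) : ỹ⁻¹ (rᵢ⁻¹ t rᵢ) ỹ ∈ H^K_m}`,
the inner count in EXACTLY the coset currency of ★ `natCard_cosets_eq_iTen` (Prop. 10).  This is ★ `natCard_fixedPoints_eq_finsum_relIndex_mul` at `G := ↥H` with
`hMK` ∕ `hPK` ∕ `hKPM` discharged by ★ Prop. 8 (i) (`mem_unitaryInt_of_flickerU_conj_mem`, `exists_upper_mul_of_mem_centralizer_unitaryInt`) and the inner count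
transported by `natCard_cosets_subgroupOf_eq`. [cite: Flicker1998UnitaryFL, Cor. 9 p. 85; Prop. 6 p. 83; Prop. 8 p. 84] -/
theorem natCard_fixedPoints_centralizer_eq_finsum (hJ : J = (StdForm.antidiagonal 3).over K) (hd : LocalConjDatum σ ϖ) {y : K}
    (hy : y * σ y = -2) (m : ℕ) {um c : ↥(unitaryGroupOfForm σ J)}
    (hum : ((um : GL (Fin 3) K) : Matrix (Fin 3) (Fin 3) K) = !![ϖ ^ m, y, (ϖ ^ m)⁻¹; 0, 1, -σ y * (ϖ ^ m)⁻¹; 0, 0, (ϖ ^ m)⁻¹])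
    (hc : ((c : GL (Fin 3) K) : Matrix (Fin 3) (Fin 3) K) = !![1, 0, 0; 0, -1, 0; 0, 0, 1])
    {ι : Type*} (r : ι → ↥(Subgroup.centralizer ({c} : Set ↥(unitaryGroupOfForm σ J))))
    (t : ↥(Subgroup.centralizer ({c} : Set ↥(unitaryGroupOfForm σ J))))
    (T : Subgroup ↥(Subgroup.centralizer ({c} : Set ↥(unitaryGroupOfForm σ J)))) (ht : ∀ τ ∈ T, τ * t = t * τ)
    (hA : ∀ g : ↥(Subgroup.centralizer ({c} : Set ↥(unitaryGroupOfForm σ J))), ∃ i, ∃ τ ∈ T,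
      ∃ k ∈ (flickerKH σ J c).subgroupOf (Subgroup.centralizer ({c} : Set ↥(unitaryGroupOfForm σ J))), g = τ * r i * k)
    (hB : ∀ i j, ∀ τ ∈ T, ∀ τ' ∈ T, ∀ k ∈ (flickerKH σ J c).subgroupOf (Subgroup.centralizer ({c} : Set ↥(unitaryGroupOfForm σ J))),
      ∀ k' ∈ (flickerKH σ J c).subgroupOf (Subgroup.centralizer ({c} : Set ↥(unitaryGroupOfForm σ J))), τ * r i * k = τ' * r j * k' → i = j)
    (hfin : {x : ↥(Subgroup.centralizer ({c} : Set ↥(unitaryGroupOfForm σ J))) ⧸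
      (flickerHK σ J c um).subgroupOf (Subgroup.centralizer ({c} : Set ↥(unitaryGroupOfForm σ J))) | t • x = x}.Finite) :
    Nat.card {x : ↥(Subgroup.centralizer ({c} : Set ↥(unitaryGroupOfForm σ J))) ⧸
        (flickerHK σ J c um).subgroupOf (Subgroup.centralizer ({c} : Set ↥(unitaryGroupOfForm σ J))) // t • x = x} =
      ∑ᶠ i, (((flickerKH σ J c).subgroupOf (Subgroup.centralizer ({c} : Set ↥(unitaryGroupOfForm σ J)))).map
          (MulAut.conj (r i)).toMonoidHom).relIndex T *
        Nat.card {w : ↥(flickerPH σ J c) ⧸ (flickerHK σ J c um).subgroupOf (flickerPH σ J c) //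
          ((Quotient.out w : ↥(flickerPH σ J c)) : ↥(unitaryGroupOfForm σ J))⁻¹ *
              (((r i)⁻¹ * t * r i : ↥(Subgroup.centralizer ({c} : Set ↥(unitaryGroupOfForm σ J)))) : ↥(unitaryGroupOfForm σ J)) *
            (Quotient.out w : ↥(flickerPH σ J c)) ∈ flickerHK σ J c um} := by
  have hPH : flickerPH σ J c ≤ Subgroup.centralizer ({c} : Set ↥(unitaryGroupOfForm σ J)) :=
    (flickerPH_le_flickerKH σ c).trans (flickerKH_le_centralizer σ c)
  have hMK : (flickerHK σ J c um).subgroupOf (Subgroup.centralizer ({c} : Set ↥(unitaryGroupOfForm σ J))) ≤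
      (flickerKH σ J c).subgroupOf (Subgroup.centralizer ({c} : Set ↥(unitaryGroupOfForm σ J))) :=
    Subgroup.subgroupOf_mono _ (flickerHK_le_flickerKH σ hJ hd hy m hum hc)
  have hPK : (flickerPH σ J c).subgroupOf (Subgroup.centralizer ({c} : Set ↥(unitaryGroupOfForm σ J))) ≤
      (flickerKH σ J c).subgroupOf (Subgroup.centralizer ({c} : Set ↥(unitaryGroupOfForm σ J))) :=
    Subgroup.subgroupOf_mono _ (flickerPH_le_flickerKH σ c)
  rw [natCard_fixedPoints_eq_finsum_relIndex_mul T _ _ _ r t ht hMK hPK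
    (fun k hk => exists_mem_flickerPH_mul_mem_flickerHK σ hJ hd hy m hum hc k hk) hA hB hfin]
  refine finsum_congr fun i => ?_
  rw [natCard_cosets_subgroupOf_eq _ _ _ hPH]

end CorNine

end UnitaryGroup

end Literature.NumberTheory.Automorphic
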